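import Mathlib
import Summits.Ventures.DiscreteObjects.Mahler.CensusCertificateX

/-!
# The full `x ↦ -x` symmetry of the census search (venture `DiscreteObjects`, target L)

Cell `pub-namedobj`, seat `pub-namedobj-mahler-g23` (pipeline of seats g12–g22). Framing: lottery ticket; floor = certified bounds/negative
ranges.

The census verdict `degreeCensus_of_certified_nonnegXC` (mahler g15) asks for certificates only on the half of the search tree with `c₁ ≥ 0`,
because `p(-x)` has the same measure and negates `c₁`.  The same involution also negates `c₃, c₅, …`, so on the subtree `c₁ = 0` one may
still halve: it suffices to certify the SIGN-NORMAL vectors — those whose first nonzero entry among the odd-degree coefficients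
`c₁, c₃, c₅, …` (positions `0, 2, 4, …` of the half vector) is positive (`signNormal`).  This file proves the verdict in that form
(`degreeCensus_of_certified_signNormalXC`); at degree 28 the subtrees `[0, c₂, c₃ < 0]` and `[0, c₂, 0, c₄, c₅ < 0]` hold 15 % of the leaves and
18 % of the certificates.  Infrastructure only; no census row is claimed here.
-/

namespace Summit.Ventures.DiscreteObjects.Mahler

open Polynomial

/-! ## Sign-normal vectors and the alternating flip -/

/-- `signNormal a`: the first nonzero entry among the positions `0, 2, 4, …` of `a` is positive (or there is none). -/
def signNormal : List ℤ → Bool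
  | [] => true
  | [x] => decide (0 ≤ x)
  | x :: _ :: rest => if x = 0 then signNormal rest else decide (0 < x)

/-- Negate the entries at the positions `0, 2, 4, …`. -/
def flipAlt : List ℤ → List ℤ
  | [] => []
  | [x] => [-x]
  | x :: y :: rest => -x :: y :: flipAlt rest

/-- A vector that is not sign-normal becomes sign-normal after the alternating flip. -/
theorem signNormal_flipAlt_of_eq_false : ∀ l : List ℤ, signNormal l = false → signNormal (flipAlt l) = true
  | [], h => by simp [signNormal] at h
  | [x], h => by
    simp only [signNormal, flipAlt, decide_eq_false_iff_not, decide_eq_true_eq, not_le] at h ⊢; omega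
  | x :: y :: rest, h => by
    by_cases hx : x = 0
    · simp only [signNormal, flipAlt, hx, neg_zero, if_true] at h ⊢
      exact signNormal_flipAlt_of_eq_false rest h
    · have hx' : -x ≠ 0 := by omega
      simp only [signNormal, flipAlt, hx, hx', if_false, decide_eq_false_iff_not, decide_eq_true_eq, not_lt] at h ⊢; omega

/-- `flipAlt` preserves the length. -/
theorem length_flipAlt : ∀ l : List ℤ, (flipAlt l).length = l.length
  | [] => rfl
  | [_] => rfl
  | _ :: _ :: rest => by simp [flipAlt, length_flipAlt rest]

/-- The entries of `flipAlt l`. -/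
theorem getElem_flipAlt : ∀ (l : List ℤ) (i : ℕ) (hi : i < (flipAlt l).length),
    (flipAlt l)[i] = if i % 2 = 0 then -l[i]'(by rw [length_flipAlt] at hi; exact hi) else l[i]'(by rw [length_flipAlt] at hi; exact hi)
  | [], i, hi => by simp [flipAlt] at hi
  | [x], i, hi => by
    have : i = 0 := by simp [flipAlt] at hi; omega
    subst this; simp [flipAlt]
  | x :: y :: rest, i, hi => by
    match i with
    | 0 => simp [flipAlt]
    | 1 => simp [flipAlt]
    | i + 2 =>
      have hi' : i < (flipAlt rest).length := by simp [flipAlt] at hi; omega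
      simp only [flipAlt, List.getElem_cons_succ, getElem_flipAlt rest i hi', Nat.add_mod_right]

/-- A vector extending `[0, c₂, c₃]` with `c₃ < 0` is not sign-normal. -/
theorem signNormal_eq_false_of_prefix3 {c₂ c₃ : ℤ} {a : List ℤ} (h : [0, c₂, c₃] <+: a) (hc : c₃ < 0) : signNormal a = false := by
  obtain ⟨t, rfl⟩ := h
  have h1 : c₃ ≠ 0 := by omega
  have h2 : ¬ 0 < c₃ := by omega
  have h3 : ¬ 0 ≤ c₃ := by omega
  cases t with
  | nil => simp [signNormal, h3]
  | cons y t => simp [signNormal, h1, h2]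

/-- A vector extending `[0, c₂, 0, c₄, c₅]` with `c₅ < 0` is not sign-normal. -/
theorem signNormal_eq_false_of_prefix5 {c₂ c₄ c₅ : ℤ} {a : List ℤ} (h : [0, c₂, 0, c₄, c₅] <+: a) (hc : c₅ < 0) :
    signNormal a = false := by
  obtain ⟨t, rfl⟩ := h
  have h1 : c₅ ≠ 0 := by omega
  have h2 : ¬ 0 < c₅ := by omega
  have h3 : ¬ 0 ≤ c₅ := by omega
  cases t with
  | nil => simp [signNormal, h3]
  | cons y t => simp [signNormal, h1, h2]

/-- A vector extending `a₁ :: _` with `a₁ < 0` is not sign-normal. -/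
theorem signNormal_eq_false_of_head {a₁ : ℤ} {a : List ℤ} (h : [a₁] <+: a) (hc : a₁ < 0) : signNormal a = false := by
  obtain ⟨t, rfl⟩ := h
  have h1 : a₁ ≠ 0 := by omega
  have h2 : ¬ 0 < a₁ := by omega
  have h3 : ¬ 0 ≤ a₁ := by omega
  cases t with
  | nil => simp [signNormal, h3]
  | cons y t => simp [signNormal, h1, h2]

/-! ## The half vector of `p(-x)` -/

/-- `[xⁿ] p(-x) = (-1)ⁿ [xⁿ] p`. -/
theorem coeff_comp_neg_X_eq (q : ℤ[X]) (n : ℕ) : (q.comp (-X)).coeff n = (-1) ^ n * q.coeff n := by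
  induction q using Polynomial.induction_on' with
  | add p q hp hq => simp [add_comp, hp, hq, mul_add]
  | monomial k a =>
    rw [monomial_comp, coeff_monomial]
    have e : (C a * (-X) ^ k : ℤ[X]) = C (a * (-1) ^ k) * X ^ k := by
      rw [neg_pow, C_mul, C_pow, C_neg, C_1]; ring
    rw [e, coeff_C_mul_X_pow]
    by_cases hnk : n = k
    · subst hnk; simp; ring
    · simp [hnk, Ne.symm hnk]

/-- The half vector of `p(-x)` is the alternating flip of the half vector of `p` (degree `2d`). -/
theorem take_descCoeffList_comp_neg_X {p : ℤ[X]} {d : ℕ} (hdeg : p.natDegree = 2 * d) (hdeg' : (p.comp (-X)).natDegree = 2 * d) :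
    (descCoeffList (p.comp (-X))).take d = flipAlt ((descCoeffList p).take d) := by
  apply List.ext_getElem
  · rw [length_flipAlt, List.length_take, List.length_take, length_descCoeffList, length_descCoeffList, hdeg, hdeg']
  · intro i h1 h2
    have hid : i < d := by rw [List.length_take, length_descCoeffList] at h1; omega
    rw [getElem_flipAlt]
    simp only [List.getElem_take, descCoeffList, List.getElem_map, List.getElem_range, hdeg, hdeg', coeff_comp_neg_X_eq]
    have hpar : (-1 : ℤ) ^ (2 * d - 1 - i) = if i % 2 = 0 then -1 else 1 := by
      split_ifs with h
      · exact Odd.neg_one_pow ⟨d - 1 - i / 2, by omega⟩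
      · exact Even.neg_one_pow ⟨d - 1 - i / 2, by omega⟩
    rw [hpar]
    split_ifs <;> simp

/-! ## The verdict for sign-normal certificates -/

/-- **Census verdict from extended certificates on the SIGN-NORMAL half vectors only.** -/
theorem census_verdict_signNormalXC {Bn Bd d : ℕ} {T : List ℕ} {CT : List (List (List ℤ × ℤ))} {L : List (List ℤ)}
    {LC : List (List ℤ × ℤ)} (hBn : 0 < Bn) (hBd : 0 < Bd) (hd : 1 ≤ d) (hdT : d ≤ T.length)
    (hT : ThresholdsValidX d ((Bn : ℝ) / Bd) T) (hCT : CutTableValidX d ((Bn : ℝ) / Bd) CT)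
    (hLC : LeafCutsValid d ((Bn : ℝ) / Bd) LC)
    (hcert : ∀ a ∈ censusSearchC T CT d [] [], signNormal a = true →
      ∃ c, checkCertX Bn Bd d L LC (1 :: palC a) c = true)
    {p : ℤ[X]} (hmonic : p.Monic) (hdeg : p.natDegree = 2 * d)
    (hpal : ∀ j ≤ 2 * d, p.coeff j = p.coeff (2 * d - j)) (hirr : Irreducible p)
    (h1 : 1 < intMahlerMeasure p) (hB : intMahlerMeasure p < (Bn : ℝ) / Bd) :
    ∃ l ∈ L, p = ofCoeffs l ∨ p = (ofCoeffs l).comp (-X) := by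
  have key : ∀ q : ℤ[X], q.Monic → q.natDegree = 2 * d → (∀ j ≤ 2 * d, q.coeff j = q.coeff (2 * d - j)) →
      Irreducible q → 1 < intMahlerMeasure q → intMahlerMeasure q < (Bn : ℝ) / Bd → signNormal ((descCoeffList q).take d) = true →
      ∃ l ∈ L, q = ofCoeffs l ∨ q = (ofCoeffs l).comp (-X) := by
    intro q hqm hqd hqp hqi hq1 hqB hq0
    have hmem := take_descCoeffList_mem_censusSearchC_of_irreducibleXT hd hqm hqi hqd hqp hqB hdT hT hCT
    obtain ⟨c, hc⟩ := hcert _ hmem hq0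
    rw [palC_take_descCoeffList hd hqm hqd hqp] at hc
    exact certX_verdict hBn hBd hLC hqm hqd hqp hqi hq1 hqB hc
  by_cases h0 : signNormal ((descCoeffList p).take d) = true
  · exact key p hmonic hdeg hpal hirr h1 hB h0
  · rw [Bool.not_eq_true] at h0
    obtain ⟨hqm, hqd, hqp, -⟩ := comp_neg_X_palindromic hd hmonic hdeg hpal
    have hq := key (p.comp (-X)) hqm hqd hqp (irreducible_comp_neg_X hirr)
      (by rw [intMahlerMeasure_comp_neg_X]; exact h1) (by rw [intMahlerMeasure_comp_neg_X]; exact hB)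
      (by rw [take_descCoeffList_comp_neg_X hdeg hqd]; exact signNormal_flipAlt_of_eq_false _ h0)
    obtain ⟨l, hl, h⟩ := hq
    refine ⟨l, hl, ?_⟩
    rcases h with h | h
    · right; rw [← h, comp_neg_X_comp_neg_X]
    · left
      have := congrArg (fun r : ℤ[X] => r.comp (-X)) h
      simpa only [comp_neg_X_comp_neg_X] using this

/-- **From the kernel check on sign-normal vectors to a census row** (`B = Bn/Bd ≤ θ₀`): as `degreeCensus_of_certified_nonnegXC`,
with certificates required only where `signNormal`. -/
theorem degreeCensus_of_certified_signNormalXC {Bn Bd d : ℕ} {T : List ℕ} {CT : List (List (List ℤ × ℤ))}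
    {L : List (List ℤ)} {LC : List (List ℤ × ℤ)} (hBn : 0 < Bn) (hBd : 0 < Bd) (hd : 1 ≤ d) (hdT : d ≤ T.length)
    (hT : ThresholdsValidX d ((Bn : ℝ) / Bd) T) (hCT : CutTableValidX d ((Bn : ℝ) / Bd) CT)
    (hLC : LeafCutsValid d ((Bn : ℝ) / Bd) LC) (hθ : (Bn : ℝ) / Bd ≤ smythTheta)
    (hcert : ∀ a ∈ censusSearchC T CT d [] [], signNormal a = true →
      ∃ c, checkCertX Bn Bd d L LC (1 :: palC a) c = true) :
    DegreeCensus (2 * d) ((Bn : ℝ) / Bd) L := by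
  intro p hdeg hirr h1 h2
  have hrev := (reciprocal_of_measure_lt_smythTheta hirr h1 (lt_of_lt_of_le h2 hθ)).1
  have hlc : (|p.leadingCoeff| : ℝ) ≤ intMahlerMeasure p := abs_leadingCoeff_le_intMahlerMeasure p
  have hθ2 : smythTheta < 2 := by have := smythTheta_lt; linarith
  have hlc1 : p.leadingCoeff = 1 ∨ p.leadingCoeff = -1 := by
    have hne : p.leadingCoeff ≠ 0 := leadingCoeff_ne_zero.mpr hirr.ne_zero
    have hle : |p.leadingCoeff| ≤ 1 := by
      by_contra h
      push Not at h
      have : (2 : ℝ) ≤ (|p.leadingCoeff| : ℝ) := by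
        have : (2 : ℤ) ≤ |p.leadingCoeff| := h
        exact_mod_cast this
      linarith
    rcases abs_le.mp hle with ⟨h1', h2'⟩
    omega
  obtain ⟨hmonic, hpm, hMm, hdegm, hirrm⟩ := monic_normalisation hlc1
  set q := C p.leadingCoeff * p with hq
  have hrevq : q.reverse = q := by rw [hq, reverse_mul_of_domain, reverse_C, hrev]
  rw [hdeg] at hdegm
  have hpal := palindromic_of_reverse_eq_self q (2 * d) hdegm hrevq
  rw [← hMm] at h1 h2
  obtain ⟨l, hl, hql⟩ := census_verdict_signNormalXC hBn hBd hd hdT hT hCT hLC hcert hmonic hdegm hpal (hirrm hirr) h1 h2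
  refine ⟨l, hl, ?_⟩
  rcases hlc1 with hc | hc
  · have hpq : p = q := by rw [hpm, hc, C_1, one_mul]
    rcases hql with h | h
    · exact Or.inl (hpq.trans h)
    · exact Or.inr (Or.inr (Or.inl (hpq.trans h)))
  · have hpq : p = -q := by
      conv_lhs => rw [hpm, hc]
      simp
    rcases hql with h | h
    · exact Or.inr (Or.inl (by rw [hpq, h]))
    · exact Or.inr (Or.inr (Or.inr (by rw [hpq, h])))

/-! ## Vacuous certificates for the mirrored subtrees -/

/-- Every survivor below a node extends the node's prefix, so below `[0, c₂, c₃ < 0]` nothing is sign-normal. -/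
theorem forall_signNormal_of_prefix3 {T : List ℕ} {CT : List (List (List ℤ × ℤ))} {f : ℕ} {c₂ c₃ : ℤ} {ps : List ℤ}
    {P : List ℤ → Prop} (hc : c₃ < 0) :
    ∀ a ∈ censusSearchC T CT f [0, c₂, c₃] ps, signNormal a = true → P a := by
  intro a ha hs
  rw [signNormal_eq_false_of_prefix3 (isPrefix_of_mem_censusSearchC T CT f _ ps a ha) hc] at hs
  exact absurd hs (by decide)

/-- Below `[0, c₂, 0, c₄, c₅ < 0]` nothing is sign-normal. -/
theorem forall_signNormal_of_prefix5 {T : List ℕ} {CT : List (List (List ℤ × ℤ))} {f : ℕ} {c₂ c₄ c₅ : ℤ} {ps : List ℤ}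
    {P : List ℤ → Prop} (hc : c₅ < 0) :
    ∀ a ∈ censusSearchC T CT f [0, c₂, 0, c₄, c₅] ps, signNormal a = true → P a := by
  intro a ha hs
  rw [signNormal_eq_false_of_prefix5 (isPrefix_of_mem_censusSearchC T CT f _ ps a ha) hc] at hs
  exact absurd hs (by decide)

/-- Below a depth-1 node `[a₁]` with `a₁ < 0` nothing is sign-normal. -/
theorem forall_signNormal_of_head {T : List ℕ} {CT : List (List (List ℤ × ℤ))} {f : ℕ} {a₁ : ℤ} {ps : List ℤ}
    {P : List ℤ → Prop} (hc : a₁ < 0) :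
    ∀ a ∈ censusSearchC T CT f [a₁] ps, signNormal a = true → P a := by
  intro a ha hs
  rw [signNormal_eq_false_of_head (isPrefix_of_mem_censusSearchC T CT f _ ps a ha) hc] at hs
  exact absurd hs (by decide)

/-- An unconditional subtree certificate is in particular a sign-normal one. -/
theorem forall_signNormal_of_forall {T : List ℕ} {CT : List (List (List ℤ × ℤ))} {f : ℕ} {pre ps : List ℤ} {P : List ℤ → Prop}
    (h : ∀ a ∈ censusSearchC T CT f pre ps, P a) : ∀ a ∈ censusSearchC T CT f pre ps, signNormal a = true → P a :=
  fun a ha _ => h a ha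

end Summit.Ventures.DiscreteObjects.Mahler
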